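import Mathlib
import Summits.HubbardSuperconductivity.HubbardSuperconductivity.Theses.BalabanIR

/-!
# Sketch — crux-ideate stmt-HubbardSuperconductivity-2083 (BalabanIR.BirEveryGroundState), ideator k=1

First-lemma signatures for the idea cards in `Ideas/`.  Nothing here is proved; every item is a
`Prop`-valued `def` so that the file elaborates with no `sorry`.
-/

set_option linter.dupNamespace false

namespace Summit.HubbardSuperconductivity.HubbardSuperconductivity.Cruxes.BirEveryGroundState.Sketch

open Matrix Polynomial

/-! ## Card `integer-pencil-schur-residue` -/

/-- FIRST LEMMA (a): TRANSCENDENTAL COUPLINGS ARE NEVER EXCEPTIONAL.  For an affine pencil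
`T + U • D` of INTEGER symmetric matrices (the pure `t = 1, t' = 0` Hubbard torus restricted to a
sector, in the occupation-number basis, is of this form), the number of distinct eigenvalues is
maximal at every transcendental `U`: every accidental coincidence of eigenvalue branches happens at
an algebraic `U` (a root of a nonzero discriminant/resultant with integer coefficients).  Applied to
all `L` at once, ONE transcendental `U ∈ (U₁,U₂)` avoids every accidental degeneracy of every
`hubbardTorus 2 L 1 U`, with no Baire/measure bookkeeping. -/
def TranscendentalMaximisesDistinctEigenvalues : Prop :=
  ∀ (n : ℕ) (T D : Matrix (Fin n) (Fin n) ℤ), T.IsSymm → D.IsSymm →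
    ∀ U : ℝ, Transcendental ℚ U → ∀ U' : ℝ,
      ((T.map (Int.cast : ℤ → ℝ) + U' • D.map (Int.cast : ℤ → ℝ)).charpoly.roots.toFinset.card ≤
        ((T.map (Int.cast : ℤ → ℝ) + U • D.map (Int.cast : ℤ → ℝ)).charpoly.roots.toFinset.card))

/-- FIRST LEMMA (b): SCHUR SCALAR ⇒ MIN = AVERAGE.  If a Hermitian `O` commutes with a family of
matrices `ρ g` (the symmetry group restricted to the sector: translations, `D₄`, spin rotations — all
of which commute with `Δ_dᴴ Δ_d`), the ground projection `P` commutes with the same family, and the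
commutant of the family inside `P · P` is trivial (= `P` is an irreducible, multiplicity-free
block: the Schur hypothesis), then the compression `P O P` is a real scalar multiple of `P`; hence
every unit vector of the ground space has `⟨ψ, O ψ⟩ = tr(P O)/tr P`. -/
def SchurScalarCompression : Prop :=
  ∀ (n : Type) [Fintype n] [DecidableEq n] (G : Type) (ρ : G → Matrix n n ℂ)
    (P O : Matrix n n ℂ), P.IsHermitian → P * P = P → O.IsHermitian →
    (∀ g, O * ρ g = ρ g * O) → (∀ g, P * ρ g = ρ g * P) →
    (∀ X : Matrix n n ℂ, P * X * P = X → (∀ g, X * ρ g = ρ g * X) → ∃ c : ℂ, X = c • P) →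
    ∃ c : ℝ, P * O * P = (c : ℂ) • P ∧ (P.trace ≠ 0 → (c : ℂ) = (P * O).trace / P.trace)

/-- FIRST LEMMA (c): REAL STRUCTURE IS HARMLESS.  `hubbardTorus` and `Δ_dᴴΔ_d` are REAL matrices in
the occupation basis, so complex conjugation `K` maps the ground space to itself; a pair of
complex-conjugate inequivalent blocks `V ⊕ K V` forced by `K` carries equal Schur scalars.  Abstract
form: if `P O P` is block-scalar on `P = P₁ + P₂` with `P₂ = conj P₁` entrywise, `O` and `P` real…
stated minimally: entrywise-real `O`, `P₁ O P₁ = a • P₁`, `P₂ = P₁.map conj`, then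
`P₂ O P₂ = a • P₂` with the SAME real `a`. -/
def ConjugateBlocksEqualScalar : Prop :=
  ∀ (n : Type) [Fintype n] [DecidableEq n] (O P₁ : Matrix n n ℂ) (a : ℝ),
    O.map (starRingEnd ℂ) = O → P₁ * O * P₁ = (a : ℂ) • P₁ →
    (P₁.map (starRingEnd ℂ)) * O * (P₁.map (starRingEnd ℂ)) = (a : ℂ) • (P₁.map (starRingEnd ℂ))

/-- THE RESIDUE, typed (the conjecture stub the line cannot avoid): DARK-PARTNER EXCLUSION for the
pure Hubbard torus.  For the crux's data (δ, window) there is a coupling `U` in the window such that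
for all large even `L` the compressed order operator is SCALAR on the sector ground space
(equivalently: no two symmetry-inequivalent ground blocks with different d-wave pair order are
degenerate at `U`).  Written basis-free with the route's own `let`-block: `P Oᴴ… P = c • P`. -/
def DarkPartnerExclusion : Prop :=
  ∀ (δ U₁ U₂ : ℝ), δ ∈ Set.Ioo (0:ℝ) (1/2) → 0 < U₁ → U₁ < U₂ →
    ∃ U ∈ Set.Ioo U₁ U₂, ∃ L₀ : ℕ, ∀ (L : ℕ) [NeZero L], L₀ ≤ L → Even L →
      let N : ℕ := 2 * ⌊(1 - δ) * (L : ℝ) ^ 2 / 2⌋₊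
      let H := Literature.MathematicalPhysics.QuantumLattice.hubbardTorus 2 L 1 U
      let S := Literature.MathematicalPhysics.QuantumLattice.szSector
        (Λ := Literature.MathematicalPhysics.QuantumLattice.FermionTorus 2 L) N 0
      let E₀ := S ⊓ Module.End.eigenspace (Matrix.toLin' H) ((H.minEnergyOn S : ℝ) : ℂ)
      let P := Literature.MathematicalPhysics.QuantumLattice.projMatrix
        (E₀.map (Literature.MathematicalPhysics.QuantumLattice.Fock.toEuclidean
          (ι := Literature.MathematicalPhysics.QuantumLattice.Orb
            (Literature.MathematicalPhysics.QuantumLattice.FermionTorus 2 L)) :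
          Literature.MathematicalPhysics.QuantumLattice.Fock
            (Literature.MathematicalPhysics.QuantumLattice.Orb
              (Literature.MathematicalPhysics.QuantumLattice.FermionTorus 2 L)) →ₗ[ℂ]
            EuclideanSpace ℂ (Finset (Literature.MathematicalPhysics.QuantumLattice.Orb
              (Literature.MathematicalPhysics.QuantumLattice.FermionTorus 2 L)))))
      let O := Matrix.conjTranspose
          (Literature.MathematicalPhysics.QuantumLattice.pairField
            Literature.MathematicalPhysics.QuantumLattice.dWaveFormFactor L) *
        Literature.MathematicalPhysics.QuantumLattice.pairField
          Literature.MathematicalPhysics.QuantumLattice.dWaveFormFactor L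
      ∃ c : ℂ, P * O * P = c • P

/-! ## Reshape note (`RESHAPE.md`, not a card): the Samuelson / second-moment cut -/

/-- SAMUELSON ENDGAME (pure linear algebra, provable now): if the ground spectral measure of the
compressed order operator has mean `ȳ ≥ c L⁴`, second moment `≤ (1+ε) ȳ²` and at most `D` atoms
with `ε (D-1) ≤ 1/4`, then its minimum is `≥ ȳ/2`.  Abstract form over a finite family of reals. -/
def SamuelsonMinBound : Prop :=
  ∀ (d : ℕ) (y : Fin d → ℝ) (ε : ℝ), 0 < d → 0 ≤ ε → ε * ((d : ℝ) - 1) ≤ 1/4 →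
    (∑ i, y i ^ 2) / d ≤ (1 + ε) * ((∑ i, y i) / d) ^ 2 → 0 ≤ (∑ i, y i) →
    ∀ i, ((∑ j, y j) / d) / 2 ≤ y i

/-! ## Card `integer-pencil-schur-residue`, refinement of the residue: known sources of permanence -/

/-- AFFINE GROUND ENERGY FORCES JOINT EIGENVECTORS (provable now, three lines of convexity): if the
lowest energy of the Hermitian pencil `T + U • D` on a sector `K` is AFFINE in `U` on an open interval,
then every ground vector at an interior coupling is a SIMULTANEOUS eigenvector of `T` and `D` (a
"T/U state" in the sense of Bruus–Anglès d'Auriac 1997 §5.2), hence a ground vector for the whole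
interval.  Use: the only known sources of permanent degeneracy in the Hubbard pencil (η-pairing
towers, saturated-ferromagnet multiplets, k = π shell states) are joint `T`–`D` eigenvectors; such a
branch can be a dark GROUND partner on a window only if `E₀(·,L)` is affine there, and then the
ORDERED block consists of joint eigenvectors too. -/
def AffineGroundForcesJointEigen : Prop :=
  ∀ (n : Type) [Fintype n] [DecidableEq n] (T D : Matrix n n ℂ) (K : Submodule ℂ (n → ℂ))
    (u₁ u₂ a γ : ℝ), T.IsHermitian → D.IsHermitian → u₁ < u₂ →
    (∀ ψ ∈ K, T *ᵥ ψ ∈ K ∧ D *ᵥ ψ ∈ K) →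
    (∀ U ∈ Set.Ioo u₁ u₂, (T + (U : ℂ) • D).minEnergyOn K = a + γ * U) →
    ∀ U ∈ Set.Ioo u₁ u₂, ∀ ψ ∈ K, star ψ ⬝ᵥ ψ = 1 →
      (T + (U : ℂ) • D) *ᵥ ψ = ((a + γ * U : ℝ) : ℂ) • ψ →
      T *ᵥ ψ = (a : ℂ) • ψ ∧ D *ᵥ ψ = (γ : ℂ) • ψ

/-! ## Transfer `C⁼` of card `integer-pencil-schur-residue`: the equivalent min-eigenvalue form -/

/-- The crux's window-average hypothesis, verbatim (abbreviation for the transfer below). -/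
def WindowAverageHyp (δ U₁ U₂ c : ℝ) : Prop :=
  ∀ U ∈ Set.Ioo U₁ U₂, ∃ L₀ : ℕ, ∀ (L : ℕ) [NeZero L], L₀ ≤ L → Even L →
    let N : ℕ := 2 * ⌊(1 - δ) * (L : ℝ) ^ 2 / 2⌋₊
    let H := Literature.MathematicalPhysics.QuantumLattice.hubbardTorus 2 L 1 U
    let S := Literature.MathematicalPhysics.QuantumLattice.szSector
      (Λ := Literature.MathematicalPhysics.QuantumLattice.FermionTorus 2 L) N 0
    let E₀ := S ⊓ Module.End.eigenspace (Matrix.toLin' H) ((H.minEnergyOn S : ℝ) : ℂ)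
    let P := Literature.MathematicalPhysics.QuantumLattice.projMatrix
      (E₀.map (Literature.MathematicalPhysics.QuantumLattice.Fock.toEuclidean
        (ι := Literature.MathematicalPhysics.QuantumLattice.Orb
          (Literature.MathematicalPhysics.QuantumLattice.FermionTorus 2 L)) :
        Literature.MathematicalPhysics.QuantumLattice.Fock
          (Literature.MathematicalPhysics.QuantumLattice.Orb
            (Literature.MathematicalPhysics.QuantumLattice.FermionTorus 2 L)) →ₗ[ℂ]
          EuclideanSpace ℂ (Finset (Literature.MathematicalPhysics.QuantumLattice.Orb
            (Literature.MathematicalPhysics.QuantumLattice.FermionTorus 2 L)))))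
    c * (L : ℝ) ^ 4 * P.trace.re ≤
      (P * (Matrix.conjTranspose (Literature.MathematicalPhysics.QuantumLattice.pairField
        Literature.MathematicalPhysics.QuantumLattice.dWaveFormFactor L) *
        Literature.MathematicalPhysics.QuantumLattice.pairField
          Literature.MathematicalPhysics.QuantumLattice.dWaveFormFactor L)).trace.re

/-- TRANSFER `C⁼` (equivalent to the crux; EASIER: no quantifier over state sequences, one uniform
lower bound per `U`): under the window-average hypothesis there is ONE coupling `U` in the window and
`c' > 0` such that, eventually in even `L`, EVERY normalised sector ground state has
`⟨ψ, Δ_dᴴΔ_d ψ⟩ ≥ c' L⁴`.  (`C⁼ → BirEveryGroundState`: sum form of `⟨ΔᴴΔ⟩` +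
`card (halfOpenBox 2 (2k)) = (2k)²`; `BirEveryGroundState → C⁼`: minimiser sequence.) -/
def MinEigenvalueForm : Prop :=
  ∀ (δ U₁ U₂ c : ℝ), δ ∈ Set.Ioo (0:ℝ) (1/2) → 0 < U₁ → U₁ < U₂ → 0 < c →
    WindowAverageHyp δ U₁ U₂ c →
    ∃ U ∈ Set.Ioo U₁ U₂, ∃ c' : ℝ, 0 < c' ∧ ∃ L₀ : ℕ, ∀ (L : ℕ) [NeZero L], L₀ ≤ L → Even L →
      ∀ ψ : Literature.MathematicalPhysics.QuantumLattice.Fock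
          (Literature.MathematicalPhysics.QuantumLattice.Orb
            (Literature.MathematicalPhysics.QuantumLattice.FermionTorus 2 L)),
        Literature.MathematicalPhysics.QuantumLattice.IsGroundStateInSector
          (Literature.MathematicalPhysics.QuantumLattice.hubbardTorus 2 L 1 U)
          (2 * ⌊(1 - δ) * (L : ℝ) ^ 2 / 2⌋₊) 0 ψ →
        star ψ ⬝ᵥ ψ = 1 →
        c' * (L : ℝ) ^ 4 ≤
          (star ψ ⬝ᵥ ((Matrix.conjTranspose
              (Literature.MathematicalPhysics.QuantumLattice.pairField
                Literature.MathematicalPhysics.QuantumLattice.dWaveFormFactor L) *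
            Literature.MathematicalPhysics.QuantumLattice.pairField
              Literature.MathematicalPhysics.QuantumLattice.dWaveFormFactor L) *ᵥ ψ)).re

/-- The composition the crux-plan skeleton must check: `C⁼` implies the crux BY NAME. Stated as a
`Prop` here (proof = liminf bookkeeping, left to crux-plan). -/
def MinEigenvalueForm_implies_crux : Prop :=
  MinEigenvalueForm →
    Summit.HubbardSuperconductivity.HubbardSuperconductivity.Theses.BalabanIR.BirEveryGroundState

end Summit.HubbardSuperconductivity.HubbardSuperconductivity.Cruxes.BirEveryGroundState.Sketch

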